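import Mathlib
import Summits.Langlands.Langlands.Theses.QuadraticWindow
import Literature.NumberTheory.Automorphic.GaloisActionPlaces
import Literature.NumberTheory.Automorphic.GLnAdelicStructureProofs
import Literature.NumberTheory.Automorphic.BaseChangeInductionAlong
import Literature.NumberTheory.Automorphic.AsaiSign
import Literature.NumberTheory.Automorphic.UnitaryGroupAutomorphicRep
import Literature.NumberTheory.Automorphic.UnitaryLimitsOfDiscreteSeries

/-!
# Line `grs-explicit-descent` — checked skeleton for the crux
`Summit.Langlands.Langlands.Theses.QuadraticWindow.HostInducedRep` (stmt-Langlands-10902)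

Planner crux-plan, round 1.  The idea card `grs-explicit-descent` (ideator 2) was never published
to the crux directory (its folder is not mounted anywhere; all three triagers record this); by its
slug and the three triage notes it is the Ginzburg–Rallis–Soudry EXPLICIT (Fourier–Jacobi /
residual-Eisenstein) DESCENT lever, the same lever as the two published sibling cards
`generic-descent-without-endoscopy` (ideator 1) and `grs-generic-descent` (ideator 3), which all
three triagers pass and ask to be MERGED into one line headed by the STRONG descent statement
(unramified correspondence at EVERY good place) and CHAINED with the sign-law lever of the cards
`one-transparent-pane ≈ flicker-period-sign-pin`.  This file is that merged line.

## Shape of the line (five registered stubs + the kernel-checked composition)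

Write `Π := AI_{F/F₀}(π ⊗ ψ')` (`ψ'` the Hecke character with Artin avatar `eψ`), `K/F₀` a CM
quadratic extension, `τ' :=` a conjugate self-dual twist of `BC_{K/F₀}(Π)`, `σ :=` its descent to
the quasi-split unitary group `U_{K/F₀}(2n) = U(n,n)`, `r_σ` the Galois representation of `σ`.

* `stub_inducedPackage`   (S1, size M) — automorphic induction WITH CONTROL AT EVERY GUARDED PLACE:
  a cuspidal `Π` on `GL_{2n}/F₀` whose Satake polynomial at every place `v` carrying guard data is
  the induced Satake polynomial of the twisted parameters `Sat(π,w)·c_w` (tree: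
  `automorphicInduction_cyclic_cuspidal` is the a.e. form; the every-place form is Arthur–Clozel
  III.6 + local automorphic induction); riders: `ℓ ∤ disc F₀`, guarded places are cofinite.
* `stub_signedTwist`      (S2, size L; the SIGN LAW of the sibling cards lives here) — there is a
  finite set `T` of places of `F₀` such that for every CM quadratic `K/F₀` split at `T` and
  unramified above `ℓ`, and every auxiliary place `v₀`, there are a CUSPIDAL conjugate self-dual
  `τ'` on `GL_{2n}/K` with the STANDARD Asai sign (`HasAsaiSign c 1`), half-integral doubly-regular
  archimedean exponents, unramified above `ℓ`, and an `ℓ`-adic character `θ` of `Γ_K` UNTWISTING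
  the Goldring–Koskivirta Frobenius polynomials of `τ'` to the host polynomials of the crux
  (`scaleRoots` identities) at cofinitely many places and at all places over `v₀`.
* `stub_grsExplicitDescent` (S3, size XL, THE LEVER, hardest) — GRS descent for even quasi-split
  unitary groups: a conjugate self-dual cuspidal `P` on `GL_N/K` with standard Asai sign is the
  standard weak base change of a CUSPIDAL `σ` on `U_{K/F₀}(N)` which is moreover unramified with
  the expected base-change Satake parameter at EVERY place `u` with `e(u∣v) = 1` where `P` is
  unramified at `u, c•u` (the STRONG clause = ideator 1's `GenericStrongDescent`, insisted on by
  all three triagers), and whose archimedean infinitesimal characters are those of `P` (archimedean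
  compatibility, GRS/Kim–Krishnamurthy).
* `stub_gkPlacewise`      (S4, size XL) — Goldring–Koskivirta Thm 3.5.5 for cuspidal `σ` on the
  quasi-split `U_{K/F₀}(2n)` with half-integral doubly-regular infinitesimal characters, in a
  PLACEWISE form over `F₀` (Disproof.lean §6: the printed control set is indexed by rational
  primes; the crux demands every place) and twisted by an arbitrary `ℓ`-adic character `θ`
  (`U → GU`, Kottwitz datum `B = K`, and the twist algebra are inside).
* `stub_patchDescend`     (S5, size M, pure Galois theory) — patching over the family of CM
  quadratic extensions of `F₀` split at `T` and above `ℓ` (tree: `SorensenPatching`,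
  `SGeneralQuadraticFamily`, `QuadraticFamily.GoodPrime.exists_framedGaloisRep_of_compatibleAE`
  are PROVED) and reading the representation over `F₀` off the split members.
* `HostInducedRep_of : HostInducedRep` — the composition S1 → S2 → (∀ K: S3 → S4) → S5, proved
  here without `sorry` (first-order glue only; the `n = 0` stratum is excluded by the crux's own
  twist-nontriviality hypothesis, `pos_of_twistNontrivial`, copied from Disproof.lean §1).

Vocabulary gaps (line card, Definition requests): the tree has no predicate "`σ_v` is a
non-degenerate limit of discrete series" and no "`σ` is globally generic"; the archimedean
interface between S3 and S4 is therefore the infinitesimal character (`UnitaryGroup.HasHCParameterAt`)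
of shape `(k¹ ∣ k²)`, `k¹, k²` strictly decreasing in `½ + ℤ` (`HalfIntShape`), which is what the
intended objects satisfy (generic descent ⇒ large ⇒ NLDS `twinDatum`, Knapp–Zuckerman; tree
`isNondegenerateLimitOfDiscreteSeries_twinDatum`) and what GK's theorem needs up to that gap.
-/

open scoped BigOperators Polynomial Classical
open Filter Set Function Polynomial IsDedekindDomain NumberField
open Literature.NumberTheory.Automorphic Literature.NumberTheory.GaloisRepresentations
open Summit.Langlands.Langlands.Theses.QuadraticWindow

set_option linter.dupNamespace false

noncomputable section

namespace Summit.Langlands.Langlands.Cruxes.HostInducedRep.GrsExplicitDescent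

/-! ## Vocabulary of the line (abbreviations of verbatim sub-terms of the crux) -/

section Defs

variable {F₀ F : Type} [Field F₀] [NumberField F₀] [Field F] [NumberField F] [Algebra F₀ F]

/-- **The hypotheses of the crux, bundled** (verbatim, in the order of `HostInducedRep`:
`hTR, hdeg, hτ, hreg, hpol, hpar, hodd, hℓ, hunr, hψunr, hψpar, hψnti`). -/
def Hyps (τ : F ≃ₐ[F₀] F) (n : ℕ) {hcpt : isCompact_glFiniteIntegralLevel n F}
    (π : CuspidalAutomorphicRepData n F hcpt) (e : FramedGaloisRep F₀ ℂ 1) (k : ℤ)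
    (ℓ : ℕ) (eψ : FramedGaloisRep F ℂ 1) : Prop :=
  IsTotallyReal F₀ ∧ Module.finrank F₀ F = 2 ∧ τ ≠ 1 ∧ π.1.IsRegularAlgebraic ∧
  (∀ᶠ w in cofinite, ∀ (α β : Multiset ℂ) (c : ℂ), π.1.HasSatakeParamAt w α →
      π.1.HasSatakeParamAt (τ • w) β →
      e.HasFrobCharpolyAt (w.under (𝓞 F₀)) (X - C c) →
      β = α.map (fun a ↦ a⁻¹ * (c * ((w.under (𝓞 F₀)).residueCard : ℂ) ^ k) ^
        w.asIdeal.inertiaDeg (𝓞 F₀))) ∧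
  ((e.restrictField F).IsOdd ∨ ∀ (φ : F →+* ℝ) (c : Field.absoluteGaloisGroup F),
      IsComplexConjugation φ c → Matrix.GeneralLinearGroup.det ((e.restrictField F) c) = 1) ∧
  (Odd n → (e.restrictField F).IsOdd) ∧
  ¬ ((ℓ : ℤ) ∣ NumberField.discr F) ∧
  (∀ w : HeightOneSpectrum (𝓞 F), ((ℓ : ℕ) : 𝓞 F) ∈ w.asIdeal → π.1.IsUnramifiedAt w) ∧
  (∀ w : HeightOneSpectrum (𝓞 F), ((ℓ : ℕ) : 𝓞 F) ∈ w.asIdeal → eψ.IsUnramifiedAt w) ∧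
  (∀ (φ : F →+* ℝ) (c c' : Field.absoluteGaloisGroup F), IsComplexConjugation φ c →
      IsComplexConjugation (φ.comp (τ : F →+* F)) c' →
      Matrix.GeneralLinearGroup.det (eψ c) = Matrix.GeneralLinearGroup.det (eψ c')) ∧
  (∃ᶠ w in cofinite, ∃ (α β : Multiset ℂ) (c c' : ℂ), π.1.HasSatakeParamAt w α ∧
      π.1.HasSatakeParamAt (τ • w) β ∧ eψ.HasFrobCharpolyAt w (X - C c) ∧
      eψ.HasFrobCharpolyAt (τ • w) (X - C c') ∧ β.map (fun b ↦ b * c') ≠ α.map (fun a ↦ a * c))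

/-- **The guard of the crux at a place `v` of `F₀` with data `(α, c)`** (verbatim): every place
`w ∣ v` of `F` is unramified over `F₀`, `π` has Satake parameter `α w` at `w`, and `eψ` is
unramified at `w` with arithmetic-Frobenius value `c w`. -/
def Guard {n : ℕ} {hcpt : isCompact_glFiniteIntegralLevel n F}
    (π : CuspidalAutomorphicRepData n F hcpt) (eψ : FramedGaloisRep F ℂ 1)
    (v : HeightOneSpectrum (𝓞 F₀)) (α : HeightOneSpectrum (𝓞 F) → Multiset ℂ)
    (c : HeightOneSpectrum (𝓞 F) → ℂ) : Prop :=
  ∀ w : HeightOneSpectrum (𝓞 F), w.under (𝓞 F₀) = v →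
    w.asIdeal.ramificationIdx (𝓞 F₀) = 1 ∧ π.1.HasSatakeParamAt w (α w) ∧ eψ.IsUnramifiedAt w ∧
      eψ.HasFrobCharpolyAt w (X - C (c w))

/-- **The host polynomial at `v`** (verbatim: the finprod in the conclusion of the crux):
`∏_{w ∣ v} P_w(X^{f(w∣v)})`, `P_w = arithFrobPolyOfSatake ι q_w n (α_w · c_w)`. -/
def hostPoly {ℓ : ℕ} [Fact ℓ.Prime] (ι : PadicAlgCl ℓ ≃+* ℂ) (n : ℕ)
    (α : HeightOneSpectrum (𝓞 F) → Multiset ℂ) (c : HeightOneSpectrum (𝓞 F) → ℂ)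
    (v : HeightOneSpectrum (𝓞 F₀)) : (PadicAlgCl ℓ)[X] :=
  ∏ᶠ w ∈ {w : HeightOneSpectrum (𝓞 F) | w.under (𝓞 F₀) = v},
    Polynomial.expand (PadicAlgCl ℓ) (w.asIdeal.inertiaDeg (𝓞 F₀))
      (arithFrobPolyOfSatake ι w.residueCard n ((α w).map (fun a ↦ a * c w)))

end Defs

/-- **The squares polynomial** `∏_{a ∈ roots P} (X - a²)`: the characteristic polynomial of `A²`
when `P = char(A)` is monic and split (the Frobenius at a place of residue degree `2` is the square
of the Frobenius below it; cf. the tree's `QuadraticFamily.frobPoly E v 2`). -/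
def sqPoly {R : Type*} [CommRing R] [IsDomain R] (P : R[X]) : R[X] :=
  (P.roots.map fun a ↦ X - C (a ^ 2)).prod

/-- **Half-integral doubly-regular shape** of a multiset of `2n` complex numbers: `M = k¹ ∪ k²` for
two strictly decreasing `n`-tuples of half-integers `k¹, k² : Fin n → ½ + ℤ` (possibly equal).
This is the infinitesimal character `(k¹ ∣ k²)` of a non-degenerate limit of discrete series of
`U(n,n)` singular at noncompact roots only (`LDSDatum`, `twinDatum` when `k¹ = k²`; integrality
`param ∈ ½ + ℤ` is forced for `U(n,n)`, `LDSDatum.param_ne_intCast`), and, on the `GL_{2n}(ℂ)` side,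
the holomorphic-exponent multiset of a "type I" doubled parameter. -/
def HalfIntShape (n : ℕ) (M : Multiset ℂ) : Prop :=
  ∃ k₁ k₂ : Fin n → ℚ, StrictAnti k₁ ∧ StrictAnti k₂ ∧ (∀ t, ∃ m : ℤ, k₁ t = m + 1 / 2) ∧
    (∀ t, ∃ m : ℤ, k₂ t = m + 1 / 2) ∧
    M = (Finset.univ.val.map fun t ↦ ((k₁ t : ℚ) : ℂ)) + (Finset.univ.val.map fun t ↦ ((k₂ t : ℚ) : ℂ))

section KLevel

variable {F₀ F : Type} [Field F₀] [NumberField F₀] [Field F] [NumberField F] [Algebra F₀ F]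

/-- **Induced package**: `Π` (cuspidal on `GL_{2n}/F₀`) has, at EVERY place `v` carrying guard
data `(α, c)`, a Satake parameter whose Satake polynomial is the induced Satake polynomial
`∏_{w ∣ v} ∏_{a ∈ α_w c_w} (X^{f(w∣v)} - a)` (tree `inducedSatakePolynomial`; Arthur–Clozel Ch. 3,
Def. 6.1 (6.1)–(6.2)) — i.e. `Π` looks like `AI_{F/F₀}(π ⊗ ψ')` at every guarded place, not only
at almost all of them. -/
def IsInducedPackage {n : ℕ} {hcpt : isCompact_glFiniteIntegralLevel n F}
    (π : CuspidalAutomorphicRepData n F hcpt) (eψ : FramedGaloisRep F ℂ 1)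
    {hcpt₀ : isCompact_glFiniteIntegralLevel (2 * n) F₀}
    (PInd : CuspidalAutomorphicRepData (2 * n) F₀ hcpt₀) : Prop :=
  ∀ (v : HeightOneSpectrum (𝓞 F₀)) (α : HeightOneSpectrum (𝓞 F) → Multiset ℂ)
    (c : HeightOneSpectrum (𝓞 F) → ℂ), Guard π eψ v α c →
    ∃ B : Multiset ℂ, PInd.1.HasSatakeParamAt v B ∧
      satakePolynomial B = inducedSatakePolynomial v (fun w ↦ (α w).map (fun a ↦ a * c w))

/-- **Admissible CM quadratic extensions** `K/F₀` (with involution `cK`) for the level `ℓ` and the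
finite set `T` of places of `F₀`: `[K:F₀] = 2`, `cK ≠ 1`, `K` totally complex (hence CM when `F₀`
is totally real), every place of `K` above `ℓ` unramified over `F₀`, and every `t ∈ T` split in
`K` (`e = f = 1` at the places above `t`).  The patching family of `stub_patchDescend`
(`F₀(√-D)`, `D` prime in a congruence class) consists of such `K`. -/
def Adm (ℓ : ℕ) (T : Finset (HeightOneSpectrum (𝓞 F₀))) (K : Type) [Field K] [NumberField K]
    [Algebra F₀ K] (cK : K ≃ₐ[F₀] K) : Prop :=
  Module.finrank F₀ K = 2 ∧ cK ≠ 1 ∧ IsTotallyComplex K ∧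
    (∀ u : HeightOneSpectrum (𝓞 K), ((ℓ : ℕ) : 𝓞 K) ∈ u.asIdeal →
      u.asIdeal.ramificationIdx (𝓞 F₀) = 1) ∧
    (∀ t ∈ T, ∀ u : HeightOneSpectrum (𝓞 K), u.under (𝓞 F₀) = t →
      u.asIdeal.ramificationIdx (𝓞 F₀) = 1 ∧ u.asIdeal.inertiaDeg (𝓞 F₀) = 1)

variable {K : Type} [Field K] [NumberField K] [Algebra F₀ K]

/-- **Twist control at a place `u` of `K`** for the pair `(τ', θ)` of `stub_signedTwist`: for every
guard datum `(α, c)` at the place `v` of `F₀` below `u` with `v ∤ ℓ` and `e(u∣v) = 1`, `τ'` is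
unramified at `u` and `cK • u`, and for every Satake parameter `β` of `τ'` at `u` the `ℓ`-adic
character `θ` has an arithmetic-Frobenius value `t` at `u` which UNTWISTS the Goldring–Koskivirta
Frobenius polynomial `arithFrobPolyOfSatake ι q_u (2n) β` to the host polynomial at `v`
(`f(u∣v) = 1`) resp. to its squares polynomial (`f(u∣v) = 2`):
`(∏_{b ∈ β} (X - ι⁻¹((q_u^{(2n-1)/2} b)⁻¹))).scaleRoots t`.  On paper, with
`τ' = BC_K(Π) ⊗ ψ₀'`, `Sat(τ',u) = Sat(Π,v)^{f(u∣v)} · ψ₀'(ϖ_u)` and `t = ι⁻¹(q_u^{n/2} ψ₀'(ϖ_u))`,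
the value at `Frob_u` of the avatar of the ALGEBRAIC character `ψ₀' ‖·‖^{-n/2}` (integral infinity
type exactly because the exponents of `τ'` lie in `½ + ℤ`). -/
def TwistCtrl {n : ℕ} {hcpt : isCompact_glFiniteIntegralLevel n F}
    (π : CuspidalAutomorphicRepData n F hcpt) (eψ : FramedGaloisRep F ℂ 1)
    {ℓ : ℕ} [Fact ℓ.Prime] (ι : PadicAlgCl ℓ ≃+* ℂ) (cK : K ≃ₐ[F₀] K)
    {hcptK : isCompact_glFiniteIntegralLevel (2 * n) K}
    (τ' : CuspidalAutomorphicRepData (2 * n) K hcptK) (θ : FramedGaloisRep K (PadicAlgCl ℓ) 1)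
    (u : HeightOneSpectrum (𝓞 K)) : Prop :=
  ∀ (α : HeightOneSpectrum (𝓞 F) → Multiset ℂ) (c : HeightOneSpectrum (𝓞 F) → ℂ),
    ((ℓ : ℕ) : 𝓞 F₀) ∉ (u.under (𝓞 F₀)).asIdeal → Guard π eψ (u.under (𝓞 F₀)) α c →
    u.asIdeal.ramificationIdx (𝓞 F₀) = 1 →
      τ'.1.IsUnramifiedAt u ∧ τ'.1.IsUnramifiedAt (cK • u) ∧
      ∀ β : Multiset ℂ, τ'.1.HasSatakeParamAt u β →
        ∃ t : PadicAlgCl ℓ, θ.HasFrobCharpolyAt u (X - C t) ∧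
          (u.asIdeal.inertiaDeg (𝓞 F₀) = 1 →
            (arithFrobPolyOfSatake ι u.residueCard (2 * n) β).scaleRoots t =
              hostPoly ι n α c (u.under (𝓞 F₀))) ∧
          (u.asIdeal.inertiaDeg (𝓞 F₀) = 2 →
            (arithFrobPolyOfSatake ι u.residueCard (2 * n) β).scaleRoots t =
              sqPoly (hostPoly ι n α c (u.under (𝓞 F₀))))

/-- **Specification of the signed twist `(τ', θ)` over `K` with auxiliary place `v₀`**
(conclusion of `stub_signedTwist`): (a) `τ'` conjugate self-dual a.e. (`IsConjSelfDualAE`);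
(b) STANDARD Asai sign (`HasAsaiSign cK 1`: `L^S(s, τ', As^{(-1)^{2n-1}}) = L^S(s, τ', As⁻)` has
the pole — the sign for which the descent to the quasi-split `U_{K/F₀}(2n)` along the standard
base change `ξ_1` exists); (c) archimedean parameter of half-integral doubly-regular shape at every
complex embedding (`HalfIntShape`: the "type I" condition = the SIGN LAW of the sibling cards);
(d) `τ'` unramified at `u` and `cK • u` for every place `u` above `ℓ` (which is unramified over
`F₀`); (e) twist control (`TwistCtrl`) at all but finitely many places of `K` and at every place
above `v₀`. -/
def SignedTwistSpec {n : ℕ} {hcpt : isCompact_glFiniteIntegralLevel n F}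
    (π : CuspidalAutomorphicRepData n F hcpt) (eψ : FramedGaloisRep F ℂ 1)
    {ℓ : ℕ} [Fact ℓ.Prime] (ι : PadicAlgCl ℓ ≃+* ℂ) (cK : K ≃ₐ[F₀] K)
    {hcptK : isCompact_glFiniteIntegralLevel (2 * n) K}
    (τ' : CuspidalAutomorphicRepData (2 * n) K hcptK) (θ : FramedGaloisRep K (PadicAlgCl ℓ) 1)
    (v₀ : HeightOneSpectrum (𝓞 F₀)) : Prop :=
  τ'.1.IsConjSelfDualAE cK ∧ τ'.1.HasAsaiSign cK 1 ∧
  (∃ χ : (K →+* ℂ) → Multiset ℂ, τ'.1.HasArchParameter χ ∧ ∀ σe : K →+* ℂ, HalfIntShape n (χ σe)) ∧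
  (∀ u : HeightOneSpectrum (𝓞 K), ((ℓ : ℕ) : 𝓞 K) ∈ u.asIdeal →
    u.asIdeal.ramificationIdx (𝓞 F₀) = 1 ∧ τ'.1.IsUnramifiedAt u ∧ τ'.1.IsUnramifiedAt (cK • u)) ∧
  (∀ᶠ u : HeightOneSpectrum (𝓞 K) in cofinite, TwistCtrl π eψ ι cK τ' θ u) ∧
  (∀ u : HeightOneSpectrum (𝓞 K), u.under (𝓞 F₀) = v₀ → TwistCtrl π eψ ι cK τ' θ u)

end KLevel

/-- **Patch control at a place `u` of `K`** for the abstract patching lemma `stub_patchDescend`: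
for every polynomial `P` controlled at the place `v` below `u` (`Ctrl v P`) and `e(u∣v) = 1`, the
representation `r` of `Γ_K` is unramified at `u` with arithmetic-Frobenius characteristic
polynomial `P` if `f(u∣v) = 1` and `sqPoly P` if `f(u∣v) = 2`. -/
def PatchCtrl {F₀ : Type} [Field F₀] [NumberField F₀] {K : Type} [Field K] [NumberField K]
    [Algebra F₀ K] {ℓ : ℕ} [Fact ℓ.Prime] {m : ℕ}
    (Ctrl : HeightOneSpectrum (𝓞 F₀) → (PadicAlgCl ℓ)[X] → Prop)
    (r : FramedGaloisRep K (PadicAlgCl ℓ) m) (u : HeightOneSpectrum (𝓞 K)) : Prop :=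
  ∀ P : (PadicAlgCl ℓ)[X], Ctrl (u.under (𝓞 F₀)) P → u.asIdeal.ramificationIdx (𝓞 F₀) = 1 →
    r.IsUnramifiedAt u ∧ (u.asIdeal.inertiaDeg (𝓞 F₀) = 1 → r.HasFrobCharpolyAt u P) ∧
      (u.asIdeal.inertiaDeg (𝓞 F₀) = 2 → r.HasFrobCharpolyAt u (sqPoly P))

/-- **The controlled polynomials of the crux at a place `v` of `F₀`**: `v ∤ ℓ` and `P` is the host
polynomial of some guard datum `(α, c)` at `v` (all such `P` coincide, by uniqueness of Satake
parameters and of Frobenius values — Disproof.lean §5 — but the line never needs this). -/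
def CtrlOf (F₀ : Type) {F : Type} [Field F₀] [NumberField F₀] [Field F] [NumberField F] [Algebra F₀ F]
    {n : ℕ} {hcpt : isCompact_glFiniteIntegralLevel n F}
    (π : CuspidalAutomorphicRepData n F hcpt) (eψ : FramedGaloisRep F ℂ 1)
    {ℓ : ℕ} [Fact ℓ.Prime] (ι : PadicAlgCl ℓ ≃+* ℂ) :
    HeightOneSpectrum (𝓞 F₀) → (PadicAlgCl ℓ)[X] → Prop := fun v P ↦
  ((ℓ : ℕ) : 𝓞 F₀) ∉ v.asIdeal ∧
    ∃ (α : HeightOneSpectrum (𝓞 F) → Multiset ℂ) (c : HeightOneSpectrum (𝓞 F) → ℂ),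
      Guard π eψ v α c ∧ P = hostPoly ι n α c v

/-! ## The five stubs -/

/-- **Stub S1 — the induced package with control at every guarded place (Arthur–Clozel
automorphic induction, every-place form; size M).**  Under the hypotheses of the crux there is a
CUSPIDAL automorphic representation `Π` of `GL_{2n}(𝔸_{F₀})` — on paper `Π = AI_{F/F₀}(π ⊗ ψ')`,
`ψ'` the finite-order Hecke character of `F` whose value at a uniformizer `ϖ_w` is the
arithmetic-Frobenius value `c_w` of the Artin avatar `eψ` (class field theory; `π ⊗ ψ'` is
cuspidal and NOT `τ`-invariant by `hψnti`, so the induction is cuspidal, Arthur–Clozel Ch. 3,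
Thm. 6.2 with Lemma 6.4 = tree fact `automorphicInduction_cyclic_cuspidal`) — such that at EVERY
place `v` of `F₀` carrying guard data `(α, c)` (every `w ∣ v` unramified over `F₀`, `π` with
Satake parameter `α_w`, `eψ` unramified with Frobenius value `c_w`) `Π` is unramified with Satake
polynomial the induced Satake polynomial of the twisted parameters `α_w c_w` (`IsInducedPackage`;
the tree fact is the ALMOST-EVERYWHERE relation `IsAutomorphicInductionAlong`, the every-place
upgrade is local–global compatibility of automorphic induction at unramified places:
Arthur–Clozel Ch. 3 §6 with Ch. 1 §6, Henniart–Herb).  Riders (needed downstream by the patching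
stub, consequences of the hypotheses): `ℓ ∤ disc F₀` (from `ℓ ∤ disc F`, `disc F₀² ∣ disc F`,
Mathlib `NumberField.not_dvd_discr_iff_isUnramifiedIn` + `Ideal.ramificationIdx_algebra_tower`), and
all but finitely many places `v` of `F₀` are prime to `ℓ` and carry guard data (Flath
`hasSatakeParamAt_cofinite_holds`; the Artin avatar `eψ` has finite image hence is unramified with
a Frobenius value almost everywhere; `F/F₀` is unramified almost everywhere).  Uses the crux's
`hψnti` (cuspidality of the induction) and nothing archimedean. -/
theorem stub_inducedPackage :
    ∀ (F₀ F : Type) [Field F₀] [NumberField F₀] [Field F] [NumberField F] [Algebra F₀ F]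
      (τ : F ≃ₐ[F₀] F) (n : ℕ) (hcpt : isCompact_glFiniteIntegralLevel n F)
      (π : CuspidalAutomorphicRepData n F hcpt) (e : FramedGaloisRep F₀ ℂ 1) (k : ℤ)
      (ℓ : ℕ) [Fact ℓ.Prime] (eψ : FramedGaloisRep F ℂ 1),
      Hyps τ n π e k ℓ eψ →
      ∃ PInd : CuspidalAutomorphicRepData (2 * n) F₀ (isCompact_glFiniteIntegralLevel_holds (2 * n) F₀),
        IsInducedPackage π eψ PInd ∧ ¬ ((ℓ : ℤ) ∣ NumberField.discr F₀) ∧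
        ∀ᶠ v : HeightOneSpectrum (𝓞 F₀) in cofinite, ((ℓ : ℕ) : 𝓞 F₀) ∉ v.asIdeal ∧
          ∃ (α : HeightOneSpectrum (𝓞 F) → Multiset ℂ) (c : HeightOneSpectrum (𝓞 F) → ℂ),
            Guard π eψ v α c := by
  sorry

/-- **Stub S2 — the signed conjugate self-dual twist over admissible CM quadratic fields
(base change + class field theory + THE SIGN LAW; size L).**  Under the hypotheses of the crux and
given the induced package `Π` of S1, there is a finite set `T` of places of `F₀` (on paper: one
place `t_ω` with `ω(t_ω) ≠ 1` for each of the finitely many non-trivial self-twists `Π ≅ Π ⊗ ω`,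
among them `ω_{F/F₀}`, so that `Π ≇ Π ⊗ ω_{K/F₀}` and `BC_{K/F₀}(Π)` is CUSPIDAL for every `K`
split at `T`, Arthur–Clozel Ch. 3 Thm. 4.2) such that for every admissible `K` (`Adm`: CM
quadratic over `F₀` with involution `cK`, split at `T`, unramified above `ℓ`) and every auxiliary
place `v₀` of `F₀` there are a cuspidal `τ'` on `GL_{2n}/K` and an `ℓ`-adic character
`θ : Γ_K → ℚ̄_ℓ^×` with `SignedTwistSpec`: on paper `τ' = BC_K(Π) ⊗ ψ₀'` where `ψ₀'` is a Hecke
character of `K` with `ψ₀' (ψ₀')^c = (η* ∘ N_{K/F₀})⁻¹` (times a conjugate-symplectic unitary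
character of half-integral infinity type when `n` is odd), `η* ∈ {η, η ω_{F/F₀}}` the polarization
character of `Π` with CONSTANT sign at the real places (this is where `hpar` and the
`e ↔ e·ω_{F/F₀}` switch enter: Disproof.lean §8bis, evidence note `polarized_transfer`;
BLGGT arXiv:1010.2561 Lemma A.2.5 supplies `ψ₀'` unramified above `ℓ` and above `v₀`), chosen in
the conjugate-SYMPLECTIC class, so that (a) `τ'` is conjugate self-dual, (b) its Asai sign is the
standard one `HasAsaiSign cK 1` (Flicker–Rallis/Shahidi dichotomy `Mok2014_partialAsaiL_pole_dichotomy`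
+ the flip by a conjugate-symplectic character), and (c) AT THE SAME TIME every archimedean exponent
multiset is of half-integral doubly-regular shape `(k¹ ∣ k²)` (`HalfIntShape`): the compatibility
of (b) and (c) is the SIGN LAW — lever of the sibling cards `one-transparent-pane ≈
flicker-period-sign-pin`: at a complex place of `F` the `F/F₀`-Asai pole gives a Flicker–Rallis
period, hence local `(GL_n(ℝ), μ)`-distinction of `π'_w`, and Kemarsky's necessary condition
[Kem15, Thm 1.3] = Pattanayak–Wu–Zhang arXiv:2501.14449 Thm 3.1/3.3 pins `μ_v(-1) = (-1)^{n-1+k}`,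
i.e. type I at every real place (triage r1-1 §B, r1-2 §A, r1-3 §derivation re-derived it
independently; automatic for odd `n` by central characters).  (d) `τ'` is unramified above `ℓ`
(`hunr`, `hψunr`, `K` unramified above `ℓ`, `ψ₀'` unramified above `ℓ`).  (e) The untwisting
character `θ` is the `ℓ`-adic avatar of the ALGEBRAIC Hecke character `ψ₀' ‖·‖^{-n/2}` (Weil;
tree `HeckeCharacterGaloisAvatarProofs`), and the `scaleRoots` identities of `TwistCtrl` are the
bookkeeping `Sat(τ',u) = Sat(Π,v)^{f(u∣v)} ψ₀'(ϖ_u)` (base change, Arthur–Clozel Ch. 3 Thm. 4.2 at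
every unramified place), `Sat(Π,v) =` the `f(w∣v)`-th roots of the `α_w c_w` (S1), and
`roots(hostPoly) = {ι⁻¹(q_v^{-(n-1)/2} b⁻¹) : b ∈ Sat(Π,v)}`; they hold at all places where
`ψ₀'` is unramified — all but finitely many, and all places above `v₀` by the choice of `ψ₀'`.
Honours Disproof.lean: uses `hpar` (and possibly `hodd`) exactly where §7/§8bis say the engine needs
them; the `n = 1` calibration of triage r1-1 §C / r1-3 is the first unit test. -/
theorem stub_signedTwist :
    ∀ (F₀ F : Type) [Field F₀] [NumberField F₀] [Field F] [NumberField F] [Algebra F₀ F]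
      (τ : F ≃ₐ[F₀] F) (n : ℕ) (hcpt : isCompact_glFiniteIntegralLevel n F)
      (π : CuspidalAutomorphicRepData n F hcpt) (e : FramedGaloisRep F₀ ℂ 1) (k : ℤ)
      (ℓ : ℕ) [Fact ℓ.Prime] (ι : PadicAlgCl ℓ ≃+* ℂ) (eψ : FramedGaloisRep F ℂ 1),
      Hyps τ n π e k ℓ eψ →
      ∀ PInd : CuspidalAutomorphicRepData (2 * n) F₀ (isCompact_glFiniteIntegralLevel_holds (2 * n) F₀),
        IsInducedPackage π eψ PInd →
        ∃ T : Finset (HeightOneSpectrum (𝓞 F₀)),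
          ∀ (K : Type) [Field K] [NumberField K] [Algebra F₀ K] (cK : K ≃ₐ[F₀] K),
            Adm ℓ T K cK → ∀ v₀ : HeightOneSpectrum (𝓞 F₀),
              ∃ (τ' : CuspidalAutomorphicRepData (2 * n) K (isCompact_glFiniteIntegralLevel_holds (2 * n) K))
                (θ : FramedGaloisRep K (PadicAlgCl ℓ) 1), SignedTwistSpec π eψ ι cK τ' θ v₀ := by
  sorry

/-- **Stub S3 — THE LEVER: Ginzburg–Rallis–Soudry explicit descent to the quasi-split unitary
group, strong form (size XL, hardest).**  Let `K/F₀` be a quadratic extension of number fields with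
non-trivial automorphism `cK`, `N ≥ 1`, and `P` a CUSPIDAL automorphic representation of
`GL_N(𝔸_K)` which is conjugate self-dual (a.e. on Satake parameters) with the standard Asai sign
(`HasAsaiSign cK 1`: `L^S(s, P, As^{(-1)^{N-1}})` has its pole at `s = 1`).  Then there is a
CUSPIDAL automorphic representation `σ` of Mok's quasi-split `U_{K/F₀}(N)(𝔸_{F₀})` such that
(i) `P` is the standard weak base change of `σ` (`IsWeakBaseChange`, a.e.); (ii) STRONG clause: at
EVERY finite place `u` of `K` unramified over `F₀` at which `P` is unramified (at `u` and `cK • u`),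
`σ` has a hyperspecial-spherical vector with base-change Satake parameter the Satake parameter of
`P` at `u` (`HasBaseChangeSatakeAt`); (iii) archimedean compatibility on infinitesimal characters:
at every complex place `w` of `K` fixed by `cK` the Harish-Chandra parameter of `σ_{w∣F₀}`
(`HasHCParameterAt`) is the archimedean parameter of `P` at an embedding defining `w`.
Intended proof (trace-formula-free): `σ :=` an irreducible summand of the GRS descent — the space of
Fourier–Jacobi coefficients of the residue at the Asai pole of the Siegel-type Eisenstein series on
`U_{K/F₀}(2N)` induced from `P` — which is non-zero, CUSPIDAL and globally GENERIC with weak lift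
`P` (Ginzburg–Rallis–Soudry 2011, doi:10.1142/7742, Ch. 3 and Ch. 11 (Thm "Langlands (weak)
functorial lift and descent"); announcement Ann. of Math. 150 (1999); Soudry, Astérisque 298 (2005);
Morimoto, Trans. AMS 370 (2018) doi:10.1090/tran/7119 for EVEN unitary groups; restated in the held
book Getz–Hahn 2024 Thm 13.7.4 with Thm 13.7.1 = Cogdell–Kim–PS–Shahidi / Kim–Krishnamurthy IMRP
2005 strong generic transfer `U_{2n} → Res GL_{2n}` "functorial at all archimedean places and all
finite places where unramified"); (ii) from genericity: the Kim–Krishnamurthy lift of `σ` is `P` by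
strong multiplicity one, so at `u` with `P_u` unramified `σ_u` is generic with unramified
`γ`-factors, hence spherical with the matching parameter (GRS Ch. 11 unramified correspondence;
for the dyadic / residual places a local converse theorem for generic representations of
`U(n,n)(F₀,v)`, Morimoto 2018, Q. Zhang arXiv:1509.00900, Atobe 2025 doi:10.1017/fms.2025.2);
(iii) = the archimedean part of the same functoriality.  WHY IT MIGHT FAIL (triage r1-1 K2,
r1-2 (α)(β), r1-3 sharpen (a)): the printed unramified correspondence may exclude places above 2 or
where the additive character ramifies, and newform theory for generic representations of EVEN
quasi-split unitary groups at inert places is recent — the clause "EVERY `u` with `e(u∣v) = 1`" is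
exactly what the crux's controlled set consumes, so it is kept strong here.  Barrier
`TwistedEndoscopySelfDual`: its conditionality clause (TWFL, Mok) is evaded — this is evasion (iv)
catalogued in the barrier file — and its self-duality clause is respected (`P` conjugate self-dual).
Genericity of `σ` is not expressible in the tree yet (definition request
`UnitaryGroup.IsGloballyGeneric`); the stub records its CONSEQUENCES (ii), (iii). -/
theorem stub_grsExplicitDescent :
    ∀ (F₀ K : Type) [Field F₀] [NumberField F₀] [Field K] [NumberField K] [Algebra F₀ K]
      (cK : K ≃ₐ[F₀] K), Module.finrank F₀ K = 2 → ∀ (hc : cK ≠ 1) (N : ℕ)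
      (hcptK : isCompact_glFiniteIntegralLevel N K) (P : CuspidalAutomorphicRepData N K hcptK),
      0 < N → P.1.IsConjSelfDualAE cK → P.1.HasAsaiSign cK 1 →
      ∃ σ : UnitaryGroup.CuspidalAutomorphicRepData F₀ K cK N hcptK,
        UnitaryGroup.IsWeakBaseChange F₀ K cK N hcptK P.1 σ.1 ∧
        (∀ (u : HeightOneSpectrum (𝓞 K)) (β : Multiset ℂ), u.asIdeal.ramificationIdx (𝓞 F₀) = 1 →
          P.1.HasSatakeParamAt u β → P.1.IsUnramifiedAt (cK • u) →
          UnitaryGroup.HasBaseChangeSatakeAt F₀ K cK N hcptK σ.1 u β) ∧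
        (∀ χ : (K →+* ℂ) → Multiset ℂ, P.1.HasArchParameter χ →
          ∀ (w : {w : InfinitePlace K // w.IsComplex}) (hw : cK • w.1 = w.1),
            ∃ σe : K →+* ℂ, InfinitePlace.mk σe = w.1 ∧
              UnitaryGroup.HasHCParameterAt F₀ K cK N (StdForm.antidiagonal N) hcptK σ.1 hw hc
                (χ σe)) := by
  sorry

/-- **Stub S4 — Goldring–Koskivirta Thm 3.5.5 for the quasi-split `U_{K/F₀}(2n)`, PLACEWISE over
`F₀` and twisted (size XL).**  Let `F₀` be totally real, `K/F₀` a totally complex (hence CM)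
quadratic extension with involution `cK ≠ 1`, `ℓ` a prime unramified in `F₀` and such that the
places of `K` above `ℓ` are unramified over `F₀` (so `ℓ ∉ Ram(G)` for `G = GU_{K/F₀}(n,n)/ℚ`),
`ι : ℚ̄_ℓ ≃ ℂ`, and `σ` a CUSPIDAL automorphic representation of the quasi-split `U_{K/F₀}(2n)`
which is unramified above `ℓ` and whose infinitesimal character at every real place of `F₀` (every
complex place `w` of `K`, all fixed by `cK`) is of half-integral doubly-regular shape `(k¹ ∣ k²)`
(`HalfIntShape` — the infinitesimal character of a non-degenerate limit of discrete series of
`U(n,n)` singular only at noncompact roots; C-algebraic).  Then for every `ℓ`-adic character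
`θ : Γ_K → ℚ̄_ℓ^×` there is a continuous semisimple `r : Γ_K → GL_{2n}(ℚ̄_ℓ)` — on paper
`r = ρ_{σ,ι} ⊗ θ` — such that at EVERY finite place `u` of `K` with `u ∤ ℓ` (read on `F₀`),
`e(u∣F₀) = 1`, `σ` hyperspecial-unramified at `u` with base-change Satake parameter `β`, and `θ`
with arithmetic-Frobenius value `t` at `u`: `r` is unramified at `u` with characteristic polynomial
`(arithFrobPolyOfSatake ι q_u (2n) β).scaleRoots t = ∏_{b ∈ β} (X - t ι⁻¹((q_u^{(2n-1)/2} b)⁻¹))`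
(the tree's Harris–Lan–Taylor–Thorne / Clozel normalisation of `rec(BC(σ)_u ⊗ |·|^{(1-2n)/2})`,
twisted).  Intended proof: extend `σ` to the unitary similitude group `GU_{K/F₀}(n,n)`
(Clozel–Harris–Labesse; the route's Sorensen2020 doi:10.1017/9781108649711.012), whose PEL datum
(`B = K`, `V = K^{2n}`, signature `(n,n)` at every real place) is a unitary Kottwitz datum
(Goldring 2014 doi:10.1112/s0010437x13007355 §2 — acq-02542 — and GK Rem. 3.4.4); `σ_∞` is a
C-algebraic non-degenerate limit of discrete series (THIS is where the tree's vocabulary is short: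
only the infinitesimal character is typed — definition request
`UnitaryGroup.IsLimitOfDiscreteSeriesAt`; the intended `σ` is the GENERIC descent of S3, whose
archimedean components are the large members `twinDatum … ε_gen` of the type-I packet, all `2^n`
members of which are non-degenerate LDS, tree `isNondegenerateLimitOfDiscreteSeries_twinDatum`;
triage r1-2/r1-3 checked the R-group `(ℤ/2)^n` bookkeeping); apply Goldring–Koskivirta
arXiv:1507.05032 Thm 3.5.5 / Thm 11.1 (read p. 19; alternative engines Pilloni–Stroh 2016, Boxer
arXiv:1507.05922); twist by `θ` (`char(t·A) = char(A).scaleRoots t`).  PLACEWISE STRENGTHENING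
(Disproof.lean §6, `HostInducedRepRatControl`): GK's printed control set is "all `w` over rational
`p ∉ Ram(G) ∪ Ram(π)`", `Ram(G) ⊇ {p ∣ disc F₀}`; the crux demands every place `v ∤ ℓ` of `F₀`, so
this stub asserts compatibility at `u` as soon as `σ` is unramified at `u`.  The placewise form IS
the shape printed by Fakhruddin–Pilloni 2021, Thm 9.10 (2) (`WD(r|_{Γ_{K_v}})^{F-ss} = rec(Π_v ⊗
|det|^{(1-N)/2})` at EVERY `v ∤ ℓ`, for weakly regular odd conjugate self-dual `Π`; their descent
Thm 9.6 uses Mok, which this line replaces by S3, but their coherent-cohomology-to-Galois step with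
full local–global compatibility away from `ℓ` — re-proved and extended to `p` by Boxer–Pilloni 2021
Thm 6.11 (higher Coleman theory) — is exactly the engine this stub needs; cf. the gen-2 sketch
`Cruxes/HostInducedRep/SketchIdeator3.lean §3 FPWeaklyRegularOddCM`); with GK alone the fallback is
the rational-prime version + the planner repair of Disproof §6.
Barriers: `NonRegularWeightBarrier` entered on purpose in its NLDS stratum (strata Hasse
invariants); `ShimuraVarietyRealizationBarrier` evaded by the transfer to `GU(n,n)`. -/
theorem stub_gkPlacewise :
    ∀ (F₀ K : Type) [Field F₀] [NumberField F₀] [Field K] [NumberField K] [Algebra F₀ K]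
      (cK : K ≃ₐ[F₀] K), IsTotallyReal F₀ → Module.finrank F₀ K = 2 → ∀ (hc : cK ≠ 1),
      IsTotallyComplex K → ∀ (n : ℕ) (ℓ : ℕ) [Fact ℓ.Prime] (ι : PadicAlgCl ℓ ≃+* ℂ),
      ¬ ((ℓ : ℤ) ∣ NumberField.discr F₀) →
      (∀ u : HeightOneSpectrum (𝓞 K), ((ℓ : ℕ) : 𝓞 K) ∈ u.asIdeal →
        u.asIdeal.ramificationIdx (𝓞 F₀) = 1) →
      ∀ (hcptK : isCompact_glFiniteIntegralLevel (2 * n) K)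
        (σ : UnitaryGroup.CuspidalAutomorphicRepData F₀ K cK (2 * n) hcptK),
        (∀ (w : {w : InfinitePlace K // w.IsComplex}) (hw : cK • w.1 = w.1), ∃ Λ : Multiset ℂ,
          UnitaryGroup.HasHCParameterAt F₀ K cK (2 * n) (StdForm.antidiagonal (2 * n)) hcptK σ.1 hw hc Λ ∧
            ∃ k₁ k₂ : Fin n → ℚ, StrictAnti k₁ ∧ StrictAnti k₂ ∧ (∀ t, ∃ m : ℤ, k₁ t = m + 1 / 2) ∧
              (∀ t, ∃ m : ℤ, k₂ t = m + 1 / 2) ∧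
              Λ = (Finset.univ.val.map fun t ↦ ((k₁ t : ℚ) : ℂ)) +
                (Finset.univ.val.map fun t ↦ ((k₂ t : ℚ) : ℂ))) →
        (∀ u : HeightOneSpectrum (𝓞 K), ((ℓ : ℕ) : 𝓞 K) ∈ u.asIdeal →
          UnitaryGroup.IsUnramifiedAt F₀ K cK (2 * n) hcptK σ.1 u) →
        ∀ θ : FramedGaloisRep K (PadicAlgCl ℓ) 1,
          ∃ r : FramedGaloisRep K (PadicAlgCl ℓ) (2 * n), r.toGaloisRep.IsSemisimple ∧
            ∀ (u : HeightOneSpectrum (𝓞 K)) (β : Multiset ℂ) (t : PadicAlgCl ℓ),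
              ((ℓ : ℕ) : 𝓞 F₀) ∉ (u.under (𝓞 F₀)).asIdeal →
              u.asIdeal.ramificationIdx (𝓞 F₀) = 1 →
              UnitaryGroup.HasBaseChangeSatakeAt F₀ K cK (2 * n) hcptK σ.1 u β →
              θ.HasFrobCharpolyAt u (X - C t) →
                r.IsUnramifiedAt u ∧
                  r.HasFrobCharpolyAt u ((arithFrobPolyOfSatake ι u.residueCard (2 * n) β).scaleRoots t) := by
  sorry

/-- **Stub S5 — patching over the CM quadratic extensions of `F₀` split at `T` and above `ℓ`, and
descent of the control to `F₀` (pure Galois theory + Dirichlet; size M).**  Let `F₀` be a number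
field, `ℓ` a prime, `m` a rank, `T` a finite set of places of `F₀`, and `Ctrl v P` an abstract
"controlled polynomial at `v`" predicate such that all but finitely many `v` carry a controlled
polynomial.  Suppose that for every ADMISSIBLE `K` (`Adm`: quadratic, totally complex, involution
`cK ≠ 1`, places above `ℓ` unramified over `F₀`, every `t ∈ T` split) and every place `v₀` of `F₀`
there is a continuous semisimple `r_{K,v₀} : Γ_K → GL_m(ℚ̄_ℓ)` with patch control (`PatchCtrl`:
unramified with characteristic polynomial `P`, resp. `sqPoly P`, at the places `u` with
`e(u∣v) = 1` and `f(u∣v) = 1`, resp. `2`, above a place `v` with `Ctrl v P`) at all but finitely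
many places of `K` AND at every place above `v₀`.  Then there is a continuous semisimple
`R : Γ_{F₀} → GL_m(ℚ̄_ℓ)` unramified with characteristic polynomial `P` at every `v` with
`Ctrl v P`.  Intended proof, ENTIRELY WITH PROVED TREE MATERIAL: the family `K_D = F₀(√-D)`
(`QuadraticFamily.sqrtNegField`), `D` prime with `8ℓq_T ∣ D + 1` (`q_T` = the rational primes below
`T`), is admissible (`PatchingFamily.isTotallyComplex_sqrtNegField`; `ℓ` and the `q_t` split in
`ℚ(√-D)` by `QuadraticFamily.isSquare_adicCompletion_neg_natCast` +
`QuadraticExtension.ncard_finitePlacesOver_eq_two_of_isSquare`, hence `e = f = 1` above them by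
`ramificationIdxIn_eq_one_of_ncard_eq_finrank`) and `∅`-general (`QuadraticFamily.GoodPrime.sGeneral`);
fix `v*` and put `ρ_D := r_{K_D,v*}`; almost-everywhere patch control makes each `ρ_D`
`CompatibleAE` with the datum `E v := roots(P_v)` (a characteristic polynomial over the
algebraically closed `ℚ̄_ℓ` is monic and split, so `P = ∏_{a ∈ roots P}(X - a)` and
`sqPoly P = frobPoly E v 2`), so Sorensen's hypotheses (a), (b) hold
(`CompatibleAE.nonempty_equiv_outerConj`, `GoodPrime.exists_conj` — Chebotarev + Brauer–Nesbitt)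
and `GoodPrime.exists_framedGaloisRep_of_compatibleAE` patches them to `R` with control at every
controlled `v`, the member split at `v` being `K_D` with `D` from `GoodPrime.exists_dvd_split` and
its control above `v` transported from `r_{K_D,v}` to `ρ_D ≅ r_{K_D,v}`
(`CompatibleAE.nonempty_equiv`, `isUnramifiedAt_of_equiv`, `hasFrobCharpolyAt_of_equiv`).
References: Sorensen, *A patching lemma* §1 Lemma 2 and Example (Sorensen2020); Harris–Taylor,
proof of Thm VII.1.9; Harris–Lan–Taylor–Thorne, proof of Cor 7.14. -/
theorem stub_patchDescend :
    ∀ (F₀ : Type) [Field F₀] [NumberField F₀] (ℓ : ℕ) [Fact ℓ.Prime] (m : ℕ)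
      (T : Finset (HeightOneSpectrum (𝓞 F₀)))
      (Ctrl : HeightOneSpectrum (𝓞 F₀) → (PadicAlgCl ℓ)[X] → Prop),
      (∀ᶠ v : HeightOneSpectrum (𝓞 F₀) in cofinite, ∃ P, Ctrl v P) →
      (∀ (K : Type) [Field K] [NumberField K] [Algebra F₀ K] (cK : K ≃ₐ[F₀] K),
        (Module.finrank F₀ K = 2 ∧ cK ≠ 1 ∧ IsTotallyComplex K ∧
          (∀ u : HeightOneSpectrum (𝓞 K), ((ℓ : ℕ) : 𝓞 K) ∈ u.asIdeal →
            u.asIdeal.ramificationIdx (𝓞 F₀) = 1) ∧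
          (∀ t ∈ T, ∀ u : HeightOneSpectrum (𝓞 K), u.under (𝓞 F₀) = t →
            u.asIdeal.ramificationIdx (𝓞 F₀) = 1 ∧ u.asIdeal.inertiaDeg (𝓞 F₀) = 1)) →
        ∀ v₀ : HeightOneSpectrum (𝓞 F₀), ∃ r : FramedGaloisRep K (PadicAlgCl ℓ) m,
          r.toGaloisRep.IsSemisimple ∧
          (∀ᶠ u : HeightOneSpectrum (𝓞 K) in cofinite,
            ∀ P : (PadicAlgCl ℓ)[X], Ctrl (u.under (𝓞 F₀)) P → u.asIdeal.ramificationIdx (𝓞 F₀) = 1 →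
              r.IsUnramifiedAt u ∧ (u.asIdeal.inertiaDeg (𝓞 F₀) = 1 → r.HasFrobCharpolyAt u P) ∧
                (u.asIdeal.inertiaDeg (𝓞 F₀) = 2 →
                  r.HasFrobCharpolyAt u (P.roots.map fun a ↦ X - C (a ^ 2)).prod)) ∧
          ∀ u : HeightOneSpectrum (𝓞 K), u.under (𝓞 F₀) = v₀ →
            ∀ P : (PadicAlgCl ℓ)[X], Ctrl (u.under (𝓞 F₀)) P → u.asIdeal.ramificationIdx (𝓞 F₀) = 1 →
              r.IsUnramifiedAt u ∧ (u.asIdeal.inertiaDeg (𝓞 F₀) = 1 → r.HasFrobCharpolyAt u P) ∧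
                (u.asIdeal.inertiaDeg (𝓞 F₀) = 2 →
                  r.HasFrobCharpolyAt u (P.roots.map fun a ↦ X - C (a ^ 2)).prod)) →
      ∃ R : FramedGaloisRep F₀ (PadicAlgCl ℓ) m, R.toGaloisRep.IsSemisimple ∧
        ∀ (v : HeightOneSpectrum (𝓞 F₀)) (P : (PadicAlgCl ℓ)[X]), Ctrl v P →
          R.IsUnramifiedAt v ∧ R.HasFrobCharpolyAt v P := by
  sorry

/-! ## Glue (proved): the `n = 0` stratum and the K-level assembly -/

/-- The twist-nontriviality hypothesis of the crux forces `0 < n` (a Satake parameter has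
`card = n`; copy of Disproof.lean §1 `pos_of_twistNontrivial`). -/
theorem pos_of_twistNontrivial {n : ℕ} {F : Type} [Field F] [NumberField F]
    {hcpt : isCompact_glFiniteIntegralLevel n F} (π : CuspidalAutomorphicRepData n F hcpt)
    {l : Filter (HeightOneSpectrum (𝓞 F))} (g : HeightOneSpectrum (𝓞 F) → HeightOneSpectrum (𝓞 F))
    (P Q : HeightOneSpectrum (𝓞 F) → ℂ → Prop)
    (h : ∃ᶠ w in l, ∃ (α β : Multiset ℂ) (c c' : ℂ), π.1.HasSatakeParamAt w α ∧
      π.1.HasSatakeParamAt (g w) β ∧ P w c ∧ Q w c' ∧ β.map (fun b ↦ b * c') ≠ α.map (fun a ↦ a * c)) :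
    0 < n := by
  obtain ⟨w, α, β, c, c', hα, hβ, -, -, hne⟩ := h.exists
  by_contra hn
  obtain rfl : n = 0 := Nat.eq_zero_of_not_pos hn
  have hα0 : α = 0 := Multiset.card_eq_zero.mp hα.card_eq
  have hβ0 : β = 0 := Multiset.card_eq_zero.mp hβ.card_eq
  exact hne (by rw [hα0, hβ0, Multiset.map_zero, Multiset.map_zero])

section Assembly

variable {F₀ F : Type} [Field F₀] [NumberField F₀] [Field F] [NumberField F] [Algebra F₀ F]
  {K : Type} [Field K] [NumberField K] [Algebra F₀ K]

/-- **K-level glue.**  Twist control of `(τ', θ)` at `u` (S2), the strong descent clause for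
`σ` (S3) and the twisted Goldring–Koskivirta output for `r` (S4) give patch control of `r` at `u`
for the controlled polynomials `Ctrl v P :↔ v ∤ ℓ ∧ ∃ α c, Guard v α c ∧ P = hostPoly v α c`. -/
theorem patchCtrl_of_twistCtrl {n : ℕ} {hcpt : isCompact_glFiniteIntegralLevel n F}
    (π : CuspidalAutomorphicRepData n F hcpt) (eψ : FramedGaloisRep F ℂ 1)
    {ℓ : ℕ} [Fact ℓ.Prime] (ι : PadicAlgCl ℓ ≃+* ℂ) (cK : K ≃ₐ[F₀] K)
    {hcptK : isCompact_glFiniteIntegralLevel (2 * n) K}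
    (τ' : CuspidalAutomorphicRepData (2 * n) K hcptK) (θ : FramedGaloisRep K (PadicAlgCl ℓ) 1)
    (σ : UnitaryGroup.CuspidalAutomorphicRepData F₀ K cK (2 * n) hcptK)
    (r : FramedGaloisRep K (PadicAlgCl ℓ) (2 * n))
    (hstrong : ∀ (u : HeightOneSpectrum (𝓞 K)) (β : Multiset ℂ),
      u.asIdeal.ramificationIdx (𝓞 F₀) = 1 → τ'.1.HasSatakeParamAt u β →
      τ'.1.IsUnramifiedAt (cK • u) → UnitaryGroup.HasBaseChangeSatakeAt F₀ K cK (2 * n) hcptK σ.1 u β)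
    (hr : ∀ (u : HeightOneSpectrum (𝓞 K)) (β : Multiset ℂ) (t : PadicAlgCl ℓ),
      ((ℓ : ℕ) : 𝓞 F₀) ∉ (u.under (𝓞 F₀)).asIdeal → u.asIdeal.ramificationIdx (𝓞 F₀) = 1 →
      UnitaryGroup.HasBaseChangeSatakeAt F₀ K cK (2 * n) hcptK σ.1 u β →
      θ.HasFrobCharpolyAt u (X - C t) →
        r.IsUnramifiedAt u ∧
          r.HasFrobCharpolyAt u ((arithFrobPolyOfSatake ι u.residueCard (2 * n) β).scaleRoots t))
    {u : HeightOneSpectrum (𝓞 K)} (hu : TwistCtrl π eψ ι cK τ' θ u) :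
    PatchCtrl (CtrlOf F₀ π eψ ι) r u := by
  intro P hP he
  obtain ⟨hv, α, c, hg, rfl⟩ := hP
  obtain ⟨⟨β, hβ⟩, hcu, hctrl⟩ := hu α c hv hg he
  obtain ⟨t, hθ, h1, h2⟩ := hctrl β hβ
  have hbc := hstrong u β he hβ hcu
  obtain ⟨hunr, hchar⟩ := hr u β t hv he hbc hθ
  refine ⟨hunr, fun hf ↦ ?_, fun hf ↦ ?_⟩
  · rw [← h1 hf]; exact hchar
  · rw [← h2 hf]; exact hchar

end Assembly

/-! ## The composition: the crux BY NAME from the five stubs -/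

/-- **Skeleton theorem.**  `HostInducedRep` follows from the five stubs: S1 gives the induced
package `Π` and the riders; S2 gives the finite set `T` and, for every admissible `K` and auxiliary
place `v₀`, the signed twist `(τ', θ)`; for such `K` S3 descends `τ'` to a cuspidal `σ` on
`U_{K/F₀}(2n)` with strong unramified correspondence and the archimedean shape, S4 attaches the
twisted Galois representation `r_{K,v₀}`, and the K-level glue turns twist control into patch
control; S5 patches the `r_{K,v₀}` over the admissible family to `R` over `F₀` with the crux's
conclusion at every guarded place `v ∤ ℓ`.  The only `sorry`s are inside the five stubs. -/
theorem HostInducedRep_of : HostInducedRep := by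
  intro F₀ F _ _ _ _ _ τ hTR hdeg hτ n hcpt π e k hreg hpol hpar hodd ℓ _ ι hℓ hunr eψ hψunr hψpar hψnti
  have hH : Hyps τ n π e k ℓ eψ :=
    ⟨hTR, hdeg, hτ, hreg, hpol, hpar, hodd, hℓ, hunr, hψunr, hψpar, hψnti⟩
  have hn : 0 < n := pos_of_twistNontrivial π (fun w ↦ τ • w)
    (fun w c ↦ eψ.HasFrobCharpolyAt w (X - C c)) (fun w c' ↦ eψ.HasFrobCharpolyAt (τ • w) (X - C c'))
    hψnti
  -- S1: the induced package
  obtain ⟨PInd, hPI, hℓ₀, hcof⟩ := stub_inducedPackage F₀ F τ n hcpt π e k ℓ eψ hH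
  -- S2: the signed twists over the admissible CM quadratic fields
  obtain ⟨T, hT⟩ := stub_signedTwist F₀ F τ n hcpt π e k ℓ ι eψ hH PInd hPI
  -- the controlled polynomials at a place of F₀ are cofinitely inhabited
  have hcof' : ∀ᶠ v : HeightOneSpectrum (𝓞 F₀) in cofinite, ∃ P, CtrlOf F₀ π eψ ι v P := by
    filter_upwards [hcof] with v hv
    obtain ⟨hvℓ, α, c, hg⟩ := hv
    exact ⟨hostPoly ι n α c v, hvℓ, α, c, hg, rfl⟩
  -- S3 + S4 for every admissible K, glued
  have hK : ∀ (K : Type) [Field K] [NumberField K] [Algebra F₀ K] (cK : K ≃ₐ[F₀] K), Adm ℓ T K cK →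
      ∀ v₀ : HeightOneSpectrum (𝓞 F₀), ∃ r : FramedGaloisRep K (PadicAlgCl ℓ) (2 * n),
        r.toGaloisRep.IsSemisimple ∧
          (∀ᶠ u : HeightOneSpectrum (𝓞 K) in cofinite, PatchCtrl (CtrlOf F₀ π eψ ι) r u) ∧
          ∀ u : HeightOneSpectrum (𝓞 K), u.under (𝓞 F₀) = v₀ → PatchCtrl (CtrlOf F₀ π eψ ι) r u := by
    intro K _ _ _ cK hadm v₀
    obtain ⟨h2, hc, htc, hKℓ, hKT⟩ := hadm
    obtain ⟨τ', θ, hcsd, hsign, harch, hunrℓ, hcof_u, hv₀⟩ := hT K cK ⟨h2, hc, htc, hKℓ, hKT⟩ v₀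
    obtain ⟨σ, -, hstrong, harchσ⟩ :=
      stub_grsExplicitDescent F₀ K cK h2 hc (2 * n) _ τ' (Nat.mul_pos two_pos hn) hcsd hsign
    have harch4 : ∀ (w : {w : InfinitePlace K // w.IsComplex}) (hw : cK • w.1 = w.1), ∃ Λ : Multiset ℂ,
        UnitaryGroup.HasHCParameterAt F₀ K cK (2 * n) (StdForm.antidiagonal (2 * n)) _ σ.1 hw hc Λ ∧
          HalfIntShape n Λ := by
      intro w hw
      obtain ⟨χ, hχ, hshape⟩ := harch
      obtain ⟨σe, -, hHC⟩ := harchσ χ hχ w hw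
      exact ⟨χ σe, hHC, hshape σe⟩
    have hunrσ : ∀ u : HeightOneSpectrum (𝓞 K), ((ℓ : ℕ) : 𝓞 K) ∈ u.asIdeal →
        UnitaryGroup.IsUnramifiedAt F₀ K cK (2 * n) _ σ.1 u := by
      intro u hu
      obtain ⟨he, ⟨β, hβ⟩, hcu⟩ := hunrℓ u hu
      exact ⟨β, hstrong u β he hβ hcu⟩
    obtain ⟨r, hrss, hr⟩ :=
      stub_gkPlacewise F₀ K cK hTR h2 hc htc n ℓ ι hℓ₀ hKℓ _ σ harch4 hunrσ θ
    refine ⟨r, hrss, ?_, fun u hu ↦ ?_⟩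
    · filter_upwards [hcof_u] with u hu
      exact patchCtrl_of_twistCtrl π eψ ι cK τ' θ σ r hstrong hr hu
    · exact patchCtrl_of_twistCtrl π eψ ι cK τ' θ σ r hstrong hr (hv₀ u hu)
  -- S5: patch over the family and read off over F₀
  obtain ⟨R, hRss, hR⟩ := stub_patchDescend F₀ ℓ (2 * n) T (CtrlOf F₀ π eψ ι) hcof' hK
  refine ⟨R, hRss, fun v α c hv hg ↦ ?_⟩
  exact hR v (hostPoly ι n α c v) ⟨hv, α, c, hg, rfl⟩

end Summit.Langlands.Langlands.Cruxes.HostInducedRep.GrsExplicitDescent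

end
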